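import Mathlib
import Literature.Probability.LatticeModels.GKSInequalities
import Summits.CriticalPhenomena.Ising3DConformalLimit.Theorems.PrecisionLaplacianInverseMFerromagnetOddGramDuality
import Summits.CriticalPhenomena.Ising3DConformalLimit.Theorems.PrecisionLaplacianInverseMFerromagnetLaw2Four
import Summits.CriticalPhenomena.Ising3DConformalLimit.Theorems.PrecisionLaplacianInverseMFerromagnetAfPrecisionNonnegFour
import HarnessLib

/-!
# Crux `PrecisionLaplacian.InverseMFerromagnet` (stmt-CriticalPhenomena-4798), line `Sketch` —
# stub `helper_law2_four_mtp2` (G1): `Law₂` on `{±1}⁴` for every even positive MTP₂ weight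

THEOREM-ONLY file (no definitions).  For `ν : SpinConfig (Fin 4) → ℝ` with `ν > 0`,
`ν(−ω) = ν(ω)`, `ν(ω)ν(ω') ≤ ν(ω ⊓ ω')ν(ω ⊔ ω')`, `⟨f⟩ = (∑ ν f)/(∑ ν)`, `Σ = (⟨σ_pσ_q⟩)` and
`v_A(w) = ⟨σ_Aσ_w⟩` (`|A| = 3`): `v_Aᵀ Σ⁻¹ v_B ≤ ⟨σ_Aσ_B⟩` (the pair-ferromagnet case is
`helper_law2_four`).  Proof: with the unnormalised `M_pq = ∑ ν σ_pσ_q`, `N_pq = ∑ ν u σ_pσ_q`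
(`u = σ_univ`, `σ_{univ∖i} = u σ_i`) and `M', N'` for the DUAL weight `ν' = 1/ν`, the odd-Gram
duality `ogd_core` on singletons and co-points gives `M M' + N N' = 4⁴·1`, `M N' + N M' = 0`, so
`M − N M⁻¹ N = 4⁴ M'⁻¹` and the claim is `(M'⁻¹)_ij ≥ 0`: positive definiteness on the diagonal
(`l2m_posDef`); off the diagonal `ν'` satisfies the REVERSED lattice condition, so on every
cylinder over the other two sites `W₊₊W₋₋ ≤ W₊₋W₋₊` and the conditional covariance of
`(σ_x, σ_y)` is `≤ 0` (`l2m_cyl_rl`, `l2m_sum_le`), the conditional expectation given two spins is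
odd hence linear, and the residual Schur step `afp_inv_entry_nonneg` concludes
(`l2m_inv_entry_nonneg`).  Karlin–Rinott-type MTP₂ facts; no new definitions.
-/

namespace Summit.CriticalPhenomena.Ising3DConformalLimit.Cruxes.InverseMFerromagnet.PartialCovarianceLadder

open Literature.Probability.LatticeModels Finset Matrix

noncomputable section

/-! ## Positive weights: positive definiteness, cylinder masses, flip symmetry -/

/-- For every positive weight `w` on `{±1}ⁿ` the second-moment matrix `(∑ w σ_pσ_q)` is positive
definite: `vᵀMv = ∑ w (∑ v_pσ_p)² > 0` for `v ≠ 0` (test `σ_p = sign v_p`). [folklore] -/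
theorem l2m_posDef {n : ℕ} (w : SpinConfig (Fin n) → ℝ) (hw : ∀ ω, 0 < w ω) :
    (Matrix.of fun p q : Fin n => ∑ ω, w ω * (spinAt p ω * spinAt q ω)).PosDef := by
  rw [Matrix.posDef_iff_dotProduct_mulVec]
  refine ⟨Matrix.IsHermitian.ext fun p q => ?_, fun v hv => ?_⟩
  · simp only [Matrix.of_apply, star_trivial]
    exact Finset.sum_congr rfl fun ω _ => by ring
  have hq : v ⬝ᵥ ((Matrix.of fun p q : Fin n => ∑ ω, w ω * (spinAt p ω * spinAt q ω)) *ᵥ v)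
      = ∑ ω, w ω * (∑ p, v p * spinAt p ω) ^ 2 :=
    calc v ⬝ᵥ ((Matrix.of fun p q : Fin n => ∑ ω, w ω * (spinAt p ω * spinAt q ω)) *ᵥ v)
        = ∑ p, ∑ q, ∑ ω, w ω * (v p * spinAt p ω) * (v q * spinAt q ω) := by
          simp only [dotProduct, Matrix.mulVec, Matrix.of_apply, Finset.mul_sum, Finset.sum_mul]
          exact Finset.sum_congr rfl fun p _ => Finset.sum_congr rfl fun q _ =>
            Finset.sum_congr rfl fun ω _ => by ring
      _ = ∑ p, ∑ ω, ∑ q, w ω * (v p * spinAt p ω) * (v q * spinAt q ω) :=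
          Finset.sum_congr rfl fun p _ => Finset.sum_comm
      _ = ∑ ω, ∑ p, ∑ q, w ω * (v p * spinAt p ω) * (v q * spinAt q ω) := Finset.sum_comm
      _ = ∑ ω, w ω * (∑ p, v p * spinAt p ω) ^ 2 := by
          refine Finset.sum_congr rfl fun ω _ => ?_
          rw [sq, Finset.sum_mul_sum, Finset.mul_sum]
          exact Finset.sum_congr rfl fun p _ => by
            rw [Finset.mul_sum]; exact Finset.sum_congr rfl fun q _ => by ring
  simp only [star_trivial, hq]
  let ω₀ : SpinConfig (Fin n) := fun p => if 0 ≤ v p then 1 else -1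
  have hterm : ∀ p, v p * spinAt p ω₀ = |v p| := fun p => by
    by_cases hp : 0 ≤ v p
    · simp [ω₀, spinAt, hp, abs_of_nonneg hp]
    · simp [ω₀, spinAt, hp, abs_of_neg (lt_of_not_ge hp)]
  obtain ⟨p, hp⟩ := Function.ne_iff.1 hv
  have hpos : 0 < ∑ q, |v q| :=
    Finset.sum_pos' (fun q _ => abs_nonneg _) ⟨p, Finset.mem_univ _, abs_pos.mpr hp⟩
  refine Finset.sum_pos' (fun ω _ => mul_nonneg (hw ω).le (sq_nonneg _)) ⟨ω₀, mem_univ _, ?_⟩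
  simp_rw [hterm]
  exact mul_pos (hw ω₀) (pow_pos hpos 2)

/-- Every cylinder has positive mass under a positive weight: `∑ w 1_s > 0`. [folklore] -/
theorem l2m_cyl_pos {n : ℕ} (w : SpinConfig (Fin n) → ℝ) (hw : ∀ ω, 0 < w ω) (S : Finset (Fin n))
    (s : ↥S → ℤˣ) : 0 < ∑ ω, w ω * ∏ p : ↥S, (1 + (((s p : ℤˣ) : ℤ) : ℝ) * spinAt p.1 ω) / 2 := by
  set ω₀ : SpinConfig (Fin n) := fun q => if h : q ∈ S then s ⟨q, h⟩ else 1 with hω₀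
  have h1 : (∏ p : ↥S, (1 + (((s p : ℤˣ) : ℤ) : ℝ) * spinAt p.1 ω₀) / 2) = 1 := by
    rw [cyl_eq_ite, if_pos]
    exact fun p => by simp [hω₀, p.2]
  calc (0 : ℝ) < w ω₀ * ∏ p : ↥S, (1 + (((s p : ℤˣ) : ℤ) : ℝ) * spinAt p.1 ω₀) / 2 := by
        rw [h1, mul_one]; exact hw ω₀
    _ ≤ ∑ ω, w ω * ∏ p : ↥S, (1 + (((s p : ℤˣ) : ℤ) : ℝ) * spinAt p.1 ω) / 2 :=
        Finset.single_le_sum (f := fun ω => w ω * ∏ p : ↥S,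
            (1 + (((s p : ℤˣ) : ℤ) : ℝ) * spinAt p.1 ω) / 2)
          (fun ω _ => mul_nonneg (hw ω).le (cyl_nonneg S s ω)) (Finset.mem_univ ω₀)

/-- `∑ w(ω) f(−ω) = ∑ w(ω) f(ω)` for an even weight `w`. [folklore] -/
theorem l2m_sum_comp_neg {n : ℕ} (w : SpinConfig (Fin n) → ℝ) (hev : ∀ ω, w (-ω) = w ω)
    (f : SpinConfig (Fin n) → ℝ) : ∑ ω, w ω * f (-ω) = ∑ ω, w ω * f ω := by
  calc ∑ ω, w ω * f (-ω) = ∑ ω, w (-ω) * f (-ω) := by simp_rw [hev]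
    _ = ∑ ω, w ω * f ω := Equiv.sum_comp (Equiv.neg _) (fun ω => w ω * f ω)

/-! ## The reversed lattice condition makes every conditional pair covariance nonpositive -/

/-- **`(σ_x, σ_y)` is negatively correlated on every cylinder over `S = univ ∖ {x,y}`** for a
weight `w` with the REVERSED lattice condition `w(ω ⊓ ω')w(ω ⊔ ω') ≤ w(ω)w(ω')`:
`(∑ w σ_xσ_y1_s)(∑ w 1_s) ≤ (∑ w σ_x1_s)(∑ w σ_y1_s)`, as the four weights on the cylinder obey
`W₊₊W₋₋ ≤ W₊₋W₋₊` and `(XY)(1) − (X)(Y) = 4(W₊₊W₋₋ − W₊₋W₋₊)`. [folklore] -/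
theorem l2m_cyl_rl {n : ℕ} (w : SpinConfig (Fin n) → ℝ)
    (hrl : ∀ ω ω', w (ω ⊓ ω') * w (ω ⊔ ω') ≤ w ω * w ω') {x y : Fin n} {S : Finset (Fin n)}
    (hxy : x ≠ y) (hS : S = (Finset.univ.erase x).erase y) (s : ↥S → ℤˣ) :
    (∑ ω, w ω * (spinAt x ω * spinAt y ω *
          ∏ p : ↥S, (1 + (((s p : ℤˣ) : ℤ) : ℝ) * spinAt p.1 ω) / 2)) *
        (∑ ω, w ω * ∏ p : ↥S, (1 + (((s p : ℤˣ) : ℤ) : ℝ) * spinAt p.1 ω) / 2) ≤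
      (∑ ω, w ω * (spinAt x ω * ∏ p : ↥S, (1 + (((s p : ℤˣ) : ℤ) : ℝ) * spinAt p.1 ω) / 2)) *
        (∑ ω, w ω * (spinAt y ω *
          ∏ p : ↥S, (1 + (((s p : ℤˣ) : ℤ) : ℝ) * spinAt p.1 ω) / 2)) := by
  obtain ⟨hxS, hyS⟩ : x ∉ S ∧ y ∉ S := ⟨by simp [hS], by simp [hS]⟩
  obtain ⟨e, he⟩ : ∃ e : ℤˣ → ℤˣ → SpinConfig (Fin n),
      ∀ a b p, e a b p = if hp : p ∈ S then s ⟨p, hp⟩ else if p = x then a else b :=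
    ⟨fun a b p => if hp : p ∈ S then s ⟨p, hp⟩ else if p = x then a else b, fun _ _ _ => rfl⟩
  have hex : ∀ a b, spinAt x (e a b) = ((a : ℤ) : ℝ) := fun a b => by simp [spinAt, he, hxS]
  have hey : ∀ a b, spinAt y (e a b) = ((b : ℤ) : ℝ) := fun a b => by
    simp [spinAt, he, hyS, hxy.symm]
  -- the reversed lattice inequality `W₊₊ W₋₋ ≤ W₊₋ W₋₊` on the cylinder
  have hinf : e 1 (-1) ⊓ e (-1) 1 = e (-1) (-1) := by
    funext p
    simp only [Pi.inf_apply, he]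
    split_ifs <;> first | exact inf_idem _ | decide
  have hsup : e 1 (-1) ⊔ e (-1) 1 = e 1 1 := by
    funext p
    simp only [Pi.sup_apply, he]
    split_ifs <;> first | exact sup_idem _ | decide
  have hw : w (e (-1) (-1)) * w (e 1 1) ≤ w (e 1 (-1)) * w (e (-1) 1) := by
    simpa only [hinf, hsup] using hrl (e 1 (-1)) (e (-1) 1)
  -- reduce the four sums to sums over the four points of the cylinder
  have h4 := afp_cyl_sum hxy hS s e he
  have hr : ∀ F : SpinConfig (Fin n) → ℝ,
      ∑ ω, w ω * (F ω * ∏ p : ↥S, (1 + (((s p : ℤˣ) : ℤ) : ℝ) * spinAt p.1 ω) / 2)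
        = ∑ ω, (w ω * F ω) * ∏ p : ↥S, (1 + (((s p : ℤˣ) : ℤ) : ℝ) * spinAt p.1 ω) / 2 :=
    fun F => Finset.sum_congr rfl fun ω _ => by ring
  rw [hr, hr, hr, h4, h4, h4, h4]
  simp only [hex, hey, Units.val_one, Units.val_neg, Int.cast_one, Int.cast_neg]
  nlinarith [hw]

/-- **Summing the cylinder inequalities** over a partition of unity `χ_s` with positive masses:
`∑ w σ_xσ_y ≤ ∑_s (∑ w σ_xχ_s)(∑ w σ_yχ_s)/(∑ w χ_s)`. [folklore] -/
theorem l2m_sum_le {n : ℕ} (w : SpinConfig (Fin n) → ℝ) (x y : Fin n) {ι : Type*} [Fintype ι]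
    (χ : ι → SpinConfig (Fin n) → ℝ) (hχpos : ∀ s, 0 < ∑ ω, w ω * χ s ω)
    (hχsum : ∀ ω, ∑ s, χ s ω = 1)
    (hχ : ∀ s, (∑ ω, w ω * (spinAt x ω * spinAt y ω * χ s ω)) * (∑ ω, w ω * χ s ω) ≤
      (∑ ω, w ω * (spinAt x ω * χ s ω)) * (∑ ω, w ω * (spinAt y ω * χ s ω))) :
    ∑ ω, w ω * (spinAt x ω * spinAt y ω) ≤
      ∑ s, (∑ ω, w ω * (spinAt x ω * χ s ω)) * (∑ ω, w ω * (spinAt y ω * χ s ω)) /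
        (∑ ω, w ω * χ s ω) := by
  have hsplit : ∑ ω, w ω * (spinAt x ω * spinAt y ω)
      = ∑ s, ∑ ω, w ω * (spinAt x ω * spinAt y ω * χ s ω) := by
    rw [Finset.sum_comm]
    refine Finset.sum_congr rfl fun ω _ => ?_
    rw [← Finset.mul_sum, ← Finset.mul_sum, hχsum ω, mul_one]
  rw [hsplit]
  exact Finset.sum_le_sum fun s _ => (le_div_iff₀ (hχpos s)).2 (hχ s)

/-! ## Conditioning on two spins under an even weight with the reversed lattice condition -/

/-- **Nonnegative off-diagonal precision entries under the reversed lattice condition**: for an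
even, positive weight `w` on `{±1}⁴` with `w(ω ⊓ ω')w(ω ⊔ ω') ≤ w(ω)w(ω')` and `x ≠ y`,
`((∑ w σ_pσ_q)⁻¹)_xy ≥ 0`.  With `S = univ ∖ {x,y}`: the averaged conditional covariance
`∑ w σ_xσ_y − ∑_s (∑ w σ_x1_s)(∑ w σ_y1_s)/(∑ w 1_s)` is `≤ 0` (`l2m_cyl_rl`, `l2m_sum_le`);
`s ↦ (∑ w σ_y1_s)/(∑ w 1_s)` is odd, hence linear `= ∑_q λ_q s_q` (`l2_odd_linear`), so the residual
`R_p = ∑ w σ_pσ_y − ∑_s (∑ w σ_p1_s)(∑ w σ_y1_s)/(∑ w 1_s) = ∑ w σ_pσ_y − ∑_q λ_q ∑ w σ_pσ_q`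
vanishes on `S`, and `afp_inv_entry_nonneg` turns `R_x ≤ 0` into `(M⁻¹)_xy ≥ 0`. [folklore] -/
theorem l2m_inv_entry_nonneg (w : SpinConfig (Fin 4) → ℝ) (hw : ∀ ω, 0 < w ω)
    (hev : ∀ ω, w (-ω) = w ω) (hrl : ∀ ω ω', w (ω ⊓ ω') * w (ω ⊔ ω') ≤ w ω * w ω')
    (x y : Fin 4) (hxy : x ≠ y) :
    0 ≤ (Matrix.of fun p q : Fin 4 => ∑ ω, w ω * (spinAt p ω * spinAt q ω))⁻¹ x y := by
  obtain ⟨S, hS⟩ : ∃ S : Finset (Fin 4), S = (Finset.univ.erase x).erase y := ⟨_, rfl⟩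
  have hS2 : S.card = 2 := by
    rw [hS, Finset.card_erase_of_mem (Finset.mem_erase.2 ⟨hxy.symm, Finset.mem_univ y⟩),
      Finset.card_erase_of_mem (Finset.mem_univ x), Finset.card_univ, Fintype.card_fin]
  -- the averaged conditional covariance of `(σ_x, σ_y)` over the cylinders of `S` is `≤ 0`
  have h3 := l2m_sum_le w x y
    (fun (s : ↥S → ℤˣ) (ω : SpinConfig (Fin 4)) =>
      ∏ p : ↥S, (1 + (((s p : ℤˣ) : ℤ) : ℝ) * spinAt p.1 ω) / 2)
    (l2m_cyl_pos w hw S) (sum_cyl_eq_one S) (fun s => l2m_cyl_rl w hrl hxy hS s)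
  -- cylinder indicators `ind`, masses `P s = ∑ w 1_s` and `a z s = ∑ w σ_z 1_s`, all opaque
  obtain ⟨ind, hind⟩ : ∃ ind : (↥S → ℤˣ) → SpinConfig (Fin 4) → ℝ,
      ∀ s ω, ind s ω = ∏ p : ↥S, (1 + (((s p : ℤˣ) : ℤ) : ℝ) * spinAt p.1 ω) / 2 :=
    ⟨_, fun _ _ => rfl⟩
  have hindneg : ∀ s ω, ind (-s) ω = ind s (-ω) := fun s ω => by
    simpa only [hind] using l2_ind_neg S s ω
  obtain ⟨P, hPdef⟩ : ∃ P : (↥S → ℤˣ) → ℝ, ∀ s, P s = ∑ ω, w ω * ind s ω := ⟨_, fun _ => rfl⟩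
  obtain ⟨a, hadef⟩ : ∃ a : Fin 4 → (↥S → ℤˣ) → ℝ,
      ∀ z s, a z s = ∑ ω, w ω * (spinAt z ω * ind s ω) := ⟨_, fun _ _ => rfl⟩
  simp only [← hind, ← hPdef, ← hadef] at h3
  -- positivity and flip symmetry
  have hPpos : ∀ s, 0 < P s := fun s => by
    simp only [hPdef, hind]
    exact l2m_cyl_pos w hw S s
  have hPneg : ∀ s, P (-s) = P s := fun s => by
    simp only [hPdef, hindneg]
    exact l2m_sum_comp_neg w hev (ind s)
  have haneg : ∀ z s, a z (-s) = -a z s := fun z s => by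
    rw [hadef, hadef]
    simp_rw [hindneg]
    calc ∑ ω, w ω * (spinAt z ω * ind s (-ω))
        = ∑ ω, w ω * (fun ω' => -(spinAt z ω' * ind s ω')) (-ω) :=
          Finset.sum_congr rfl fun ω _ => by simp [l2_spinAt_neg]
      _ = ∑ ω, w ω * (fun ω' => -(spinAt z ω' * ind s ω')) ω :=
          l2m_sum_comp_neg w hev (fun ω' => -(spinAt z ω' * ind s ω'))
      _ = -∑ ω, w ω * (spinAt z ω * ind s ω) := by simp only [mul_neg, Finset.sum_neg_distrib]
  -- second moments against the cylinder functions: `∑ w σ_zσ_p = ∑_s a z s · s_p` for `p ∈ S`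
  have hcol : ∀ (z : Fin 4) (p : ↥S), ∑ ω, w ω * (spinAt z ω * spinAt p.1 ω)
      = ∑ s, a z s * (((s p : ℤˣ) : ℤ) : ℝ) := fun z p => by
    simp only [hadef, Finset.sum_mul]
    rw [Finset.sum_comm]
    refine Finset.sum_congr rfl fun ω _ => ?_
    have h := l2_sum_ind_mul S ω (fun s => (((s p : ℤˣ) : ℤ) : ℝ))
    simp only [← hind] at h
    have h' : ∀ s : ↥S → ℤˣ, w ω * (spinAt z ω * ind s ω) * (((s p : ℤˣ) : ℤ) : ℝ)
        = (w ω * spinAt z ω) * (ind s ω * (((s p : ℤˣ) : ℤ) : ℝ)) := fun s => by ring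
    simp_rw [h']
    rw [← Finset.mul_sum, h]
    simp only [spinAt]
    ring
  -- `a q s = s_q · P s` for `q ∈ S`
  have haS : ∀ (q : ↥S) (s : ↥S → ℤˣ), a q.1 s = (((s q : ℤˣ) : ℤ) : ℝ) * P s := fun q s => by
    rw [hadef, hPdef, Finset.mul_sum]
    refine Finset.sum_congr rfl fun ω _ => ?_
    rw [hind, l2_ind_eq_ite]
    by_cases h : s = fun p : ↥S => ω p.1
    · rw [if_pos h, h]
      simp only [spinAt, mul_one]
      ring
    · rw [if_neg h]
      ring
  -- the conditional expectation of `σ_y` is odd, hence linear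
  have hcard : Fintype.card ↥S = 2 := by simp [hS2]
  obtain ⟨lam, hlam⟩ := l2_odd_linear hcard (fun s => a y s / P s) (fun s => by
    simp only [haneg, hPneg, neg_div])
  -- the residual `R_p = ∑ w σ_pσ_y − ∑_s a_p a_y / P = ∑ w σ_pσ_y − ∑_q λ_q ∑ w σ_pσ_q`, `R_S = 0`
  refine afp_inv_entry_nonneg _ (l2m_posDef w hw) x y S hxy hS lam
    (fun p => (∑ ω, w ω * (spinAt p ω * spinAt y ω)) - ∑ s, a p s * a y s / P s)
    (fun p => congrArg (fun t : ℝ => (∑ ω, w ω * (spinAt p ω * spinAt y ω)) - t) ?_)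
    (fun q => sub_eq_zero.2 ?_) ?_
  · calc ∑ s, a p s * a y s / P s = ∑ s, a p s * ∑ q, lam q * (((s q : ℤˣ) : ℤ) : ℝ) := by
          refine Finset.sum_congr rfl fun s _ => ?_
          rw [mul_div_assoc, hlam s]
      _ = ∑ q, lam q * ∑ s, a p s * (((s q : ℤˣ) : ℤ) : ℝ) := by
          simp_rw [Finset.mul_sum]
          rw [Finset.sum_comm]
          exact Finset.sum_congr rfl fun q _ => Finset.sum_congr rfl fun s _ => by ring
      _ = ∑ q, lam q * ∑ ω, w ω * (spinAt p ω * spinAt q.1 ω) := by simp_rw [hcol]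
  · calc ∑ ω, w ω * (spinAt q.1 ω * spinAt y ω)
        = ∑ ω, w ω * (spinAt y ω * spinAt q.1 ω) := Finset.sum_congr rfl fun ω _ => by ring
      _ = ∑ s, a y s * (((s q : ℤˣ) : ℤ) : ℝ) := hcol y q
      _ = ∑ s, a q.1 s * a y s / P s := by
          refine Finset.sum_congr rfl fun s _ => ?_
          rw [haS q s, eq_div_iff (hPpos s).ne']
          ring
  · linarith [h3]

/-! ## The registered stub -/

/-- **G1 · `helper_law2_four_mtp2` — `Law₂` on `{±1}⁴` for every even, positive weight satisfying
the FKG lattice condition.**  For `ν : SpinConfig (Fin 4) → ℝ` with `ν > 0`, `ν(−ω) = ν(ω)` and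
`ν(ω)ν(ω') ≤ ν(ω ⊓ ω')ν(ω ⊔ ω')`, and all 3-sets `A, B ⊆ Fin 4`: `v_Aᵀ Σ_ν⁻¹ v_B ≤ ⟨σ_Aσ_B⟩_ν`
where `⟨f⟩_ν = (∑ ν f)/(∑ ν)`, `Σ_ν = (⟨σ_pσ_q⟩_ν)`, `v_A(w) = ⟨σ_Aσ_w⟩_ν`.  The odd-Gram duality
`ogd_core` with the dual weight `1/ν` gives `M − N M⁻¹ N = 4⁴ (M')⁻¹` for the unnormalised
matrices; `(M')⁻¹` has positive diagonal (`l2m_posDef`) and nonnegative off-diagonal entries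
(`l2m_inv_entry_nonneg`: `1/ν` is even, positive, with the reversed lattice condition).
[folklore] -/
theorem helper_law2_four_mtp2 :
    ∀ (ν : SpinConfig (Fin 4) → ℝ), (∀ ω, 0 < ν ω) → (∀ ω, ν (-ω) = ν ω) →
      (∀ ω ω', ν ω * ν ω' ≤ ν (ω ⊓ ω') * ν (ω ⊔ ω')) →
      ∀ (A B : Finset (Fin 4)), A.card = 3 → B.card = 3 →
        dotProduct (fun w => (∑ ω, ν ω * (spinProduct A ω * spinAt w ω)) / ∑ ω, ν ω)
          (((Matrix.of fun p q : Fin 4 => (∑ ω, ν ω * (spinAt p ω * spinAt q ω)) / ∑ ω, ν ω)⁻¹).mulVec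
            (fun w => (∑ ω, ν ω * (spinProduct B ω * spinAt w ω)) / ∑ ω, ν ω))
        ≤ (∑ ω, ν ω * (spinProduct A ω * spinProduct B ω)) / ∑ ω, ν ω := by
  intro ν hpos heven hlat A B hA hB
  obtain ⟨i, rfl⟩ := l2f_card_three A hA
  obtain ⟨j, rfl⟩ := l2f_card_three B hB
  -- the dual weight `ν' = 1/ν`: positive, even, reversed lattice condition, `ν ν' = 1`
  obtain ⟨ν', hν'⟩ : ∃ ν' : SpinConfig (Fin 4) → ℝ, ∀ ω, ν' ω = (ν ω)⁻¹ := ⟨_, fun _ => rfl⟩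
  have hpos' : ∀ ω, 0 < ν' ω := fun ω => by rw [hν']; exact inv_pos.2 (hpos ω)
  have heven' : ∀ ω, ν' (-ω) = ν' ω := fun ω => by rw [hν', hν', heven]
  have hrl' : ∀ ω ω', ν' (ω ⊓ ω') * ν' (ω ⊔ ω') ≤ ν' ω * ν' ω' := fun ω ω' => by
    rw [hν', hν', hν', hν', ← mul_inv, ← mul_inv]
    exact inv_anti₀ (mul_pos (hpos ω) (hpos ω')) (hlat ω ω')
  have hνν' : ∀ ω, ν ω * ν' ω = 1 := fun ω => by rw [hν']; exact mul_inv_cancel₀ (hpos ω).ne'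
  -- the partition function and the four matrices
  set Z : ℝ := ∑ ω, ν ω with hZ
  have hZpos : 0 < Z := Finset.sum_pos (fun ω _ => hpos ω) Finset.univ_nonempty
  set M : Matrix (Fin 4) (Fin 4) ℝ :=
    Matrix.of fun p q : Fin 4 => ∑ ω, ν ω * (spinAt p ω * spinAt q ω) with hM
  set M' : Matrix (Fin 4) (Fin 4) ℝ :=
    Matrix.of fun p q : Fin 4 => ∑ ω, ν' ω * (spinAt p ω * spinAt q ω) with hM'
  set N : Matrix (Fin 4) (Fin 4) ℝ := Matrix.of fun p q : Fin 4 =>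
    ∑ ω, ν ω * (spinProduct Finset.univ ω * spinAt p ω * spinAt q ω) with hN
  set N' : Matrix (Fin 4) (Fin 4) ℝ := Matrix.of fun p q : Fin 4 =>
    ∑ ω, ν' ω * (spinProduct Finset.univ ω * spinAt p ω * spinAt q ω) with hN'
  have hMpd : M.PosDef := l2m_posDef ν hpos
  have hM'pd : M'.PosDef := l2m_posDef ν' hpos'
  -- the entries of the duality sums, for `S, T, U` singletons or co-points
  have e_single : ∀ (p : Fin 4) (ω : SpinConfig (Fin 4)), spinProduct {p} ω = spinAt p ω :=
    fun p ω => by simp [spinProduct]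
  have hMM : ∀ p k, ∑ ω, spinProduct {p} ω * spinProduct {k} ω * ν ω = M p k := fun p k => by
    simp only [hM, Matrix.of_apply, e_single]
    exact Finset.sum_congr rfl fun ω _ => by ring
  have hM'M : ∀ k q, ∑ ω, spinProduct {k} ω * spinProduct {q} ω * ν' ω = M' k q := fun k q => by
    simp only [hM', Matrix.of_apply, e_single]
    exact Finset.sum_congr rfl fun ω _ => by ring
  have hNN : ∀ p k, ∑ ω, spinProduct {p} ω * spinProduct (univ.erase k) ω * ν ω = N p k :=
    fun p k => by
    simp only [hN, Matrix.of_apply, e_single, l2f_spinProduct_erase]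
    exact Finset.sum_congr rfl fun ω _ => by ring
  have hN'N : ∀ k q, ∑ ω, spinProduct (Finset.univ.erase k) ω * spinProduct {q} ω * ν' ω
      = N' k q := fun k q => by
    simp only [hN', Matrix.of_apply, e_single, l2f_spinProduct_erase]
    exact Finset.sum_congr rfl fun ω _ => by ring
  have hN'2 : ∀ k q, ∑ ω, spinProduct {k} ω * spinProduct (Finset.univ.erase q) ω * ν' ω
      = N' k q := fun k q => by
    simp only [hN', Matrix.of_apply, e_single, l2f_spinProduct_erase]
    exact Finset.sum_congr rfl fun ω _ => by ring
  have hM'2 : ∀ k q, ∑ ω, spinProduct (Finset.univ.erase k) ω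
      * spinProduct (Finset.univ.erase q) ω * ν' ω = M' k q := fun k q => by
    simp only [hM', Matrix.of_apply, l2f_spinProduct_erase]
    refine Finset.sum_congr rfl fun ω _ => ?_
    linear_combination (spinAt k ω * spinAt q ω * ν' ω) * l2f_u_mul_u ω
  -- (I) and (II) from the duality with abstract weights
  have hdual := ogd_core ν ν' hνν' heven'
  have hI : M * M' + N * N' = ((4 : ℝ) ^ 4) • (1 : Matrix (Fin 4) (Fin 4) ℝ) := by
    ext p q
    have h := hdual {p} {q} (by simp)
    rw [l2f_sum_odd] at h
    simp only [hMM, hM'M, hNN, hN'N] at h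
    rw [Matrix.add_apply, Matrix.mul_apply, Matrix.mul_apply, Matrix.smul_apply, Matrix.one_apply,
      h]
    by_cases hpq : p = q <;> simp [Finset.singleton_inj, hpq]
  have hII : M * N' + N * M' = 0 := by
    ext p q
    have h := hdual {p} (Finset.univ.erase q)
      (by rw [Finset.card_erase_of_mem (Finset.mem_univ q)]; decide)
    rw [l2f_sum_odd] at h
    have hne : ({p} : Finset (Fin 4)) ≠ Finset.univ.erase q := fun h' => by
      simpa using congrArg Finset.card h'
    simp only [hMM, hNN, hN'2, hM'2, if_neg hne] at h
    rw [Matrix.add_apply, Matrix.mul_apply, Matrix.mul_apply, Matrix.zero_apply]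
    exact h
  -- algebra: (M - N M⁻¹ N) * M' = 4⁴ • 1, hence M - N M⁻¹ N = 4⁴ • M'⁻¹
  have hM_unit : IsUnit M.det := (Matrix.isUnit_iff_isUnit_det M).mp hMpd.isUnit
  have hM'_unit : IsUnit M'.det := (Matrix.isUnit_iff_isUnit_det M').mp hM'pd.isUnit
  have hNM' : N * M' = -(M * N') := eq_neg_of_add_eq_zero_right hII
  have hP : (M - N * M⁻¹ * N) * M' = ((4 : ℝ) ^ 4) • (1 : Matrix (Fin 4) (Fin 4) ℝ) := by
    rw [Matrix.sub_mul, Matrix.mul_assoc (N * M⁻¹), hNM', Matrix.mul_neg, sub_neg_eq_add,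
      Matrix.mul_assoc N, ← Matrix.mul_assoc M⁻¹, Matrix.nonsing_inv_mul _ hM_unit,
      Matrix.one_mul]
    exact hI
  have hPeq : M - N * M⁻¹ * N = ((4 : ℝ) ^ 4) • M'⁻¹ := by
    rw [← Matrix.mul_nonsing_inv_cancel_right M' (M - N * M⁻¹ * N) hM'_unit, hP, Matrix.smul_mul,
      Matrix.one_mul]
  -- rewrite the goal in terms of the matrices
  have hsymmN : ∀ p q, N p q = N q p := fun p q => by
    simp only [hN, Matrix.of_apply]
    exact Finset.sum_congr rfl fun ω _ => by ring
  have hv : ∀ (p w : Fin 4), (∑ ω, ν ω * (spinProduct (Finset.univ.erase p) ω * spinAt w ω))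
      = N p w := fun p w => by
    simp only [hN, Matrix.of_apply, l2f_spinProduct_erase]
  have hSiginv : (Matrix.of fun p q : Fin 4 => (∑ ω, ν ω * (spinAt p ω * spinAt q ω)) / Z)⁻¹
      = Z • M⁻¹ := by
    have hSig : (Matrix.of fun p q : Fin 4 => (∑ ω, ν ω * (spinAt p ω * spinAt q ω)) / Z)
        = Z⁻¹ • M := by
      ext p q
      simp only [hM, Matrix.smul_apply, Matrix.of_apply, smul_eq_mul, div_eq_inv_mul]
    rw [hSig]
    refine Matrix.inv_eq_left_inv ?_
    rw [Matrix.smul_mul, Matrix.mul_smul, smul_smul, Matrix.nonsing_inv_mul _ hM_unit,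
      mul_inv_cancel₀ hZpos.ne', one_smul]
  have lhs : dotProduct
        (fun w => (∑ ω, ν ω * (spinProduct (Finset.univ.erase i) ω * spinAt w ω)) / Z)
        ((Matrix.of fun p q : Fin 4 => (∑ ω, ν ω * (spinAt p ω * spinAt q ω)) / Z)⁻¹.mulVec
          fun w => (∑ ω, ν ω * (spinProduct (Finset.univ.erase j) ω * spinAt w ω)) / Z)
      = (N * (M⁻¹ * N)) i j / Z := by
    rw [hSiginv]
    simp only [hv, dotProduct, Matrix.mulVec, Matrix.smul_apply, smul_eq_mul, Matrix.mul_apply,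
      Finset.mul_sum, Finset.sum_div]
    refine Finset.sum_congr rfl fun w _ => Finset.sum_congr rfl fun z _ => ?_
    rw [hsymmN z j]
    have hZZ : Z * Z⁻¹ = 1 := mul_inv_cancel₀ hZpos.ne'
    simp only [div_eq_mul_inv]
    linear_combination (N i w * M⁻¹ w z * N j z * Z⁻¹) * hZZ
  have rhs : (∑ ω, ν ω * (spinProduct (Finset.univ.erase i) ω
        * spinProduct (Finset.univ.erase j) ω)) / Z = M i j / Z := by
    congr 1
    simp only [hM, Matrix.of_apply, l2f_spinProduct_erase]
    refine Finset.sum_congr rfl fun ω _ => ?_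
    linear_combination (ν ω * spinAt i ω * spinAt j ω) * l2f_u_mul_u ω
  -- the bracket entry `(M − N M⁻¹ N)_ij = 4⁴ (M'⁻¹)_ij` is nonnegative
  rw [lhs, rhs]
  refine div_le_div_of_nonneg_right (sub_nonneg.1 ?_) hZpos.le
  rw [← Matrix.mul_assoc, ← Matrix.sub_apply, hPeq, Matrix.smul_apply, smul_eq_mul]
  refine mul_nonneg (by positivity) ?_
  by_cases hij : i = j
  · subst hij
    exact (hM'pd.inv.diag_pos).le
  · exact l2m_inv_entry_nonneg ν' hpos' heven' hrl' i j hij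

end

end Summit.CriticalPhenomena.Ising3DConformalLimit.Cruxes.InverseMFerromagnet.PartialCovarianceLadder
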